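import Summits.ResolutionOfSingularities.ResolutionOfSingularities.Theorems.FrobeniusLadderFRationalResolutionGradedDivisorialFinite
import Summits.ResolutionOfSingularities.ResolutionOfSingularities.Theorems.FrobeniusLadderFRationalResolutionWeightGrading
import Literature.AlgebraicGeometry.Resolution.PowerSeriesRegularLocal
import Literature.AlgebraicGeometry.Resolution.RegularLocalRingsUFD
import Mathlib.GroupTheory.OrderOfElement
import HarnessLib

/-!
# Crux `FrobeniusLadder.FRationalResolution` (stmt-ResolutionOfSingularities-15317), line `redirect`,
# stub `stub_diagonalizableQuotientResolution` — ★★★ `hfin` FOR THE DEGREE-ZERO PART OF A WEIGHTED POWER SERIES RING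
# (the class-group-centre recipe's finiteness slot, down to the identification `Ê ≅ κ'[[y]]₀`)

Assembly of `…GradedDivisorialFinite` (p840298), `…WeightGrading` (p840311) and `…DivisorialGcd` (p840243):

* `isIntegral_of_graded` — if `A` is graded over a FINITE commutative group and `R` maps onto `𝒜 0`, then `A` is INTEGRAL over `R`
  (a homogeneous `x ∈ 𝒜 i` has `x^{ord i} ∈ 𝒜 0`);
* ★★ `finite_traceIdeals_divisorial_of_isIntegrallyClosed` — the finiteness of `𝒯 = {τ(I) : I ≠ 0 divisorial}` for `R` a Noetherian integrally
  closed domain mapping injectively onto the degree-zero part of a graded LOCAL UFD domain `A` (finite grading group) — `A ∩ Frac R = R` being now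
  automatic;
* ★★★ `finite_traceIdeals_divisorial_mvPowerSeries` — THE TORIC GERM CASE: `A = κ[[y₁,…,yₙ]]` with weights `w : Fin n → ℤ/r` (`r ≠ 0`), `R` a
  Noetherian integrally closed domain embedded onto the weight-zero power series: **the set of trace ideals of the nonzero divisorial ideals
  of `R` is finite** — verbatim the `hfin` hypothesis of `…CompletionDomain.hloc_of_traceIdealCentre_then_finite_singularPoints_of_isIntegrallyClosed`
  (p840173) once `Ê` is so embedded.

Honest label: algebra toward ONE leaf stub (no stub, crux or summit closed). No definitions, no named facts, no sorry.
[folklore; cite: BrunsHerzog1993, §1.5] [cite: Matsumura1987, §11; §19 p. 158; Thm. 20.3]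
-/

-- single-problem summit: the doubled namespace component is forced
set_option linter.dupNamespace false

open DirectSum SetLike
open Literature.AlgebraicGeometry.Resolution
open Summit.ResolutionOfSingularities.ResolutionOfSingularities.Theorems.FRationalResolution

namespace Summit.ResolutionOfSingularities.ResolutionOfSingularities.Theorems.FRationalResolution.GradedDegreeZeroFinite

universe u

section Graded

variable {ι σ : Type*} {A : Type u} [CommRing A] [SetLike σ A] [AddSubmonoidClass σ A] (𝒜 : ι → σ) [DecidableEq ι]
  [AddCommGroup ι] [GradedRing 𝒜]

/-- **A finitely graded ring is integral over its degree-zero part**: for `x ∈ 𝒜 i`, `x^{ord i} ∈ 𝒜 0`. [folklore] -/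
theorem isIntegral_of_graded [Finite ι] {R : Type u} [CommRing R] [Algebra R A]
    (hR0' : ∀ a : A, a ∈ 𝒜 0 → ∃ r : R, algebraMap R A r = a) : Algebra.IsIntegral R A := by
  classical
  refine ⟨fun x => ?_⟩
  rw [← sum_support_decompose 𝒜 x]
  refine IsIntegral.sum _ fun i _ => ?_
  have hpow : ((decompose 𝒜 x i : A)) ^ addOrderOf i ∈ 𝒜 0 := by
    have h := SetLike.pow_mem_graded (addOrderOf i) (SetLike.coe_mem (decompose 𝒜 x i))
    rwa [addOrderOf_nsmul_eq_zero] at h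
  obtain ⟨r, hr⟩ := hR0' _ hpow
  exact IsIntegral.of_pow (addOrderOf_pos i) (hr ▸ isIntegral_algebraMap)

/-- ★★ **Finitely many trace ideals, normal form.** As `…GradedDivisorialFinite.finite_traceIdeals_divisorial` with the hypothesis
`A ∩ Frac R = R` discharged from `R` integrally closed (`A` is integral over `R` by `isIntegral_of_graded`). [folklore; cite: BrunsHerzog1993, §1.5] -/
theorem finite_traceIdeals_divisorial_of_isIntegrallyClosed [Finite ι] [IsDomain A] [IsLocalRing A] [UniqueFactorizationMonoid A]
    {R : Type u} [CommRing R] [IsDomain R] [IsNoetherianRing R] [IsIntegrallyClosed R] [Algebra R A]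
    (hinj : Function.Injective (algebraMap R A))
    (hR0 : ∀ r : R, algebraMap R A r ∈ 𝒜 0) (hR0' : ∀ a : A, a ∈ 𝒜 0 → ∃ r : R, algebraMap R A r = a) :
    Set.Finite {T : Ideal R | ∃ I : Ideal R,
      (I ≠ ⊥ ∧ ∀ x : R, (∀ c b : R, (∀ y ∈ I, b * y ∈ Ideal.span ({c} : Set R)) → b * x ∈ Ideal.span ({c} : Set R)) → x ∈ I) ∧
      T = ⨆ φ : I →ₗ[R] R, LinearMap.range φ} := by
  haveI : Algebra.IsIntegral R A := isIntegral_of_graded 𝒜 hR0'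
  exact GradedDivisorialFinite.finite_traceIdeals_divisorial 𝒜 hinj hR0 hR0'
    (fun x r₁ r₂ hr₂ hx => DivisorialGcd.exists_algebraMap_eq_of_isIntegrallyClosed hinj x r₁ r₂ hr₂ hx)

end Graded

/-- ★★★ **`hfin` for the degree-zero part of a weighted power series ring.** `κ` a field, `w : Fin n → ℤ/r` weights (`r ≠ 0`), `R` a Noetherian
integrally closed domain with an injective ring map to `κ[[y₁,…,yₙ]]` whose image is exactly the set of power series supported on monomials of
weight `0`. Then the set of trace ideals `τ(I)` of the nonzero divisorial ideals `I` of `R` is finite. [folklore; cite: BrunsHerzog1993, §1.5]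
[cite: Matsumura1987, §19 p. 158; Thm. 20.3] -/
theorem finite_traceIdeals_divisorial_mvPowerSeries (κ : Type u) [Field κ] (n r : ℕ) [NeZero r] (w : Fin n → ZMod r)
    {R : Type u} [CommRing R] [IsDomain R] [IsNoetherianRing R] [IsIntegrallyClosed R] [Algebra R (MvPowerSeries (Fin n) κ)]
    (hinj : Function.Injective (algebraMap R (MvPowerSeries (Fin n) κ)))
    (himage : ∀ f : MvPowerSeries (Fin n) κ,
      (∃ x : R, algebraMap R (MvPowerSeries (Fin n) κ) x = f) ↔ ∀ m : Fin n →₀ ℕ, MvPowerSeries.coeff m f ≠ 0 → Finsupp.weight w m = 0) :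
    Set.Finite {T : Ideal R | ∃ I : Ideal R,
      (I ≠ ⊥ ∧ ∀ x : R, (∀ c b : R, (∀ y ∈ I, b * y ∈ Ideal.span ({c} : Set R)) → b * x ∈ Ideal.span ({c} : Set R)) → x ∈ I) ∧
      T = ⨆ φ : I →ₗ[R] R, LinearMap.range φ} := by
  classical
  obtain ⟨𝒜, inst, h𝒜⟩ := WeightGrading.exists_gradedAlgebra_weight κ w
  haveI : IsRegularLocalRing (MvPowerSeries (Fin n) κ) := (isRegularLocalRing_mvPowerSeries_fin κ n).1
  haveI : IsDomain (MvPowerSeries (Fin n) κ) := isDomain_of_isRegularLocalRing _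
  haveI : UniqueFactorizationMonoid (MvPowerSeries (Fin n) κ) := Matsumura1987_20_3_holds (MvPowerSeries (Fin n) κ) inferInstance
  refine finite_traceIdeals_divisorial_of_isIntegrallyClosed 𝒜 hinj (fun x => (h𝒜 0 _).mpr ((himage _).mp ⟨x, rfl⟩)) fun a ha => ?_
  exact (himage a).mpr ((h𝒜 0 a).mp ha)

end Summit.ResolutionOfSingularities.ResolutionOfSingularities.Theorems.FRationalResolution.GradedDegreeZeroFinite
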